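import Summits.ABC.ABC.Theses.FeketeScales
import Summits.ABC.ABC.Theorems.PrimePowerRadical.Negative.Tightness
import Literature.Barriers.ABC.ExplicitABCQualityFloor

/-!
# `SparseGoodScales` (stmt-ABC-2161): good and bad scales — the `∃ R` cannot be `∀ R`

Negative support lemmas for the crux `Summit.ABC.ABC.Theses.FeketeScales.SparseGoodScales`
(cdisprove seat, cycle 1).  `GoodScale δ R` is the matrix of the crux ("every abc triple with
`rad ≤ R` has `c ≤ R^{1+δ}`"), so that the crux is `∀ δ > 0 ∀ N ∃ R ≥ N, GoodScale δ R`
(`sparseGoodScales_iff_goodScale`, `Iff.rfl`).  Recorded here: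

* `not_goodScale_of_witness` — the SHADOW of a triple: `T` makes every scale `R` with
  `rad T ≤ R` and `R^{1+δ} < c_T` bad (so `¬ crux ⟺` some `δ₀` has shadows covering a neighbourhood
  of infinity — a covering chain of exceptional triples, i.e. a failure of abc at EVERY large scale);
* `GoodScale.mono` — goodness is monotone in `δ` (for `R ≥ 1`);
* small certified bad scales: `R = 6` is not `1/5`-good (`(1, 8, 9)`, reusing
  `PrimePowerRadical/Negative/Tightness.lean`), and Reyssat's
  `2 + 3^{10}·109 = 23^5` makes `R = 15042` bad for every `δ ≤ 0.6299`
  (`Literature.Barriers.ABC.ExplicitABCQualityFloor`);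
* hence the natural strengthening "EVERY scale is good" (`∀ R` in place of `∃ R ≥ N`) is false
  (`not_forall_goodScale`), even restricted to `δ ≤ 0.6299` and `R ≥ 15042`; under `ABC` every
  SUFFICIENTLY large scale is good (`Summit.ABC.ABC.Theorems.sparseGoodScales_of_abc`), so no
  threshold-free strengthening can be refuted further than this.
-/

noncomputable section

namespace Summit.ABC.ABC.Theorems.SparseGoodScales.Negative

open Literature.NumberTheory.DiophantineGeometry UniqueFactorizationMonoid
open Literature.Barriers.ABC

/-- `GoodScale δ R`: every abc triple with `rad(abc) ≤ R` has `c ≤ R^{1+δ}` — the matrix of the crux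
`SparseGoodScales`. -/
def GoodScale (δ : ℝ) (R : ℕ) : Prop :=
  ∀ a b c : ℕ, IsABCTriple a b c → rad a b c ≤ R → (c : ℝ) ≤ (R : ℝ) ^ (1 + δ)

/-- The crux is "for every `δ > 0` there are arbitrarily large `δ`-good scales". [folklore] -/
theorem sparseGoodScales_iff_goodScale :
    Summit.ABC.ABC.Theses.FeketeScales.SparseGoodScales ↔
      ∀ δ : ℝ, 0 < δ → ∀ N : ℕ, ∃ R : ℕ, N ≤ R ∧ GoodScale δ R :=
  Iff.rfl

/-- **Shadow of a triple.** An abc triple with `rad ≤ R` and `R^{1+δ} < c` makes the scale `R`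
bad. [folklore] -/
theorem not_goodScale_of_witness {δ : ℝ} {R a b c : ℕ} (ht : IsABCTriple a b c)
    (hr : rad a b c ≤ R) (hc : (R : ℝ) ^ (1 + δ) < c) : ¬ GoodScale δ R :=
  fun h => absurd (h a b c ht hr) (not_le.mpr hc)

/-- Goodness is monotone in the exponent (for `R ≥ 1`). [folklore] -/
theorem GoodScale.mono {δ δ' : ℝ} {R : ℕ} (hR : 1 ≤ R) (h : GoodScale δ R) (hδ : δ ≤ δ') :
    GoodScale δ' R := fun a b c ht hr =>
  (h a b c ht hr).trans
    (Real.rpow_le_rpow_of_exponent_le (by exact_mod_cast hR) (by linarith))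

/-- **The scale `R = 6` is not `1/5`-good**: `(1, 8, 9)` has `rad = 6` and `9 > 6^{6/5}`
(`rad_one_eight_nine`, `six_rpow_lt_nine` of `PrimePowerRadical/Negative/Tightness.lean`). [folklore] -/
theorem not_goodScale_six : ¬ GoodScale (1 / 5) 6 := by
  refine not_goodScale_of_witness (a := 1) (b := 8) (c := 9)
    ⟨by norm_num, by norm_num, by norm_num, by norm_num⟩
    (by rw [PrimePowerRadical.Negative.rad_one_eight_nine]) ?_
  have := PrimePowerRadical.Negative.six_rpow_lt_nine
  push_cast
  linarith

/-- **Reyssat's triple makes the scale `R = 15042` bad for every `δ ≤ 0.6299`**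
(`rad = 15042`, `c = 23^5 > 15042^{1.6299}`, `Literature.Barriers.ABC.reyssat_pow_lt`).
[cite: BombieriGubler2006, Ex. 12.4.14] -/
theorem not_goodScale_reyssat {δ : ℝ} (hδ : δ ≤ 0.6299) : ¬ GoodScale δ 15042 := by
  refine not_goodScale_of_witness reyssat_isABCTriple (by rw [rad_reyssat]) ?_
  have hq := reyssat_quality_gt
  rw [quality, rad_reyssat] at hq
  have hr1 : (1 : ℝ) ≤ ((15042 : ℕ) : ℝ) := by norm_num
  have hr : (0 : ℝ) < Real.log ((15042 : ℕ) : ℝ) := Real.log_pos (by norm_num)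
  rw [lt_div_iff₀ hr] at hq
  have h1 : ((15042 : ℕ) : ℝ) ^ (1 + δ) ≤ ((15042 : ℕ) : ℝ) ^ (1.6299 : ℝ) :=
    Real.rpow_le_rpow_of_exponent_le hr1 (by norm_num at hδ ⊢; linarith)
  have h2 : ((15042 : ℕ) : ℝ) ^ (1.6299 : ℝ) < ((23 ^ 5 : ℕ) : ℝ) := by
    rw [Real.rpow_def_of_pos (by norm_num)]
    have hc : (0 : ℝ) < ((23 ^ 5 : ℕ) : ℝ) := by norm_num
    calc Real.exp (Real.log ((15042 : ℕ) : ℝ) * 1.6299)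
        < Real.exp (Real.log ((23 ^ 5 : ℕ) : ℝ)) := Real.exp_lt_exp.mpr (by linarith)
      _ = ((23 ^ 5 : ℕ) : ℝ) := Real.exp_log hc
  exact lt_of_le_of_lt h1 h2

/-- **Not every scale is good** — the `∃ R ≥ N` of the crux cannot be strengthened to `∀ R ≥ N`
without a threshold depending on `δ`: already `δ = 1/2`, `R = 15042` fails. [folklore] -/
theorem not_forall_goodScale :
    ¬ ∀ δ : ℝ, 0 < δ → ∀ R : ℕ, 15042 ≤ R → GoodScale δ R := fun h =>
  not_goodScale_reyssat (δ := 1 / 2) (by norm_num) (h (1 / 2) (by norm_num) 15042 le_rfl)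

/-- The same below the tables' floor: no exponent `δ ≤ 0.6299` is good at ALL scales `R ≥ 15042`
(Reyssat's quality `1.6299…` is the largest known; `ExplicitABCQualityFloor`). [folklore] -/
theorem not_forall_goodScale_of_le {δ : ℝ} (hδ : δ ≤ 0.6299) :
    ¬ ∀ R : ℕ, 15042 ≤ R → GoodScale δ R := fun h =>
  not_goodScale_reyssat hδ (h 15042 le_rfl)

end Summit.ABC.ABC.Theorems.SparseGoodScales.Negative
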